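import Summits.Ventures.PercRepro.RankLevelSetLevelNineGXTArithAA
import Summits.Ventures.PercRepro.RankLevelSetLevelNineGXTArithAB
import Summits.Ventures.PercRepro.RankLevelSetLevelNineGXTArithAC
import Summits.Ventures.PercRepro.RankLevelSetLevelNineGXTArithAD
import Summits.Ventures.PercRepro.RankLevelSetLevelNineGXTArithAE
import Summits.Ventures.PercRepro.RankLevelSetLevelNineGXTArithAF
import Summits.Ventures.PercRepro.RankLevelSetLevelNineGXTArithAG
import Summits.Ventures.PercRepro.RankLevelSetLevelNineGXTArithAH
import Summits.Ventures.PercRepro.RankLevelSetLevelNineGXTArithAI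
import Summits.Ventures.PercRepro.RankLevelSetLevelNineGXTTailsA
import Summits.Ventures.PercRepro.RankLevelSetLevelNineGXTTailsB
import Summits.Ventures.PercRepro.RankLevelSetLevelNineGXTTailsC

/-!
# PercRepro — THE LEVEL-`9` DISPATCHER OF THE GX CHAIN AT BASE `208`, QUARTER ZA: the per-corank form `(c₁, c₂)`, `(P_d^gxt)`
and the `Y`-tail for `10 ≤ d ≤ 80` in one existential statement (p2, gen 35; a feeder for S4 — the top of the `q = 9` window).
The certificates of RankLevelSetLevelNineGXTArith{…} and the tail bases of RankLevelSetLevelNineGXTTails{…} lifted by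
`mul_tailG_nine_le_of_base`. Axioms: standard.
-/

set_option exponentiation.threshold 1024

namespace PercRepro

namespace ThmN

set_option maxHeartbeats 4000000 in
/-- The quarter `10 ≤ d ≤ 80` of `gxt_form_nine`. -/
theorem gxt_form_nine_ZA (d : ℕ) (hd1 : 10 ≤ d) (hd2 : d ≤ 80) (p : ℕ) (hp : 208 ≤ p) (n : ℕ) (hn : 208 + d ≤ n) :
    ∃ c₁ c₂ : ℕ, 0 < c₂ ∧ c₂ < c₁ ∧
    ((c₁ : ℕ) : ℚ) * ((((p + d).choose 9 : ℕ) : ℚ) + (∑ j ∈ Finset.range (d - 9), ((Nat.choose (min 309 (max ((d + min 151 d) / 2 + 1) (min 150 (d - 1) + 2) - 2)) j : ℕ) : ℚ) / (((j + 1) + 3 * (j + 1).choose 2 + 3 * (j + 1).choose 3 + 2 * (j + 1).choose 4 : ℕ) : ℚ)) *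
      (((d * (d + 1) / 2 : ℕ) : ℚ) * ((p + d).choose 7 : ℚ) + ((d * (d + 1) * (d + 2) / 3 : ℕ) : ℚ) * ((p + d).choose 6 : ℚ) + ((7 * d * (d + 1) * (d + 2) * (d + 3) / 48 : ℕ) : ℚ) * ((p + d).choose 5 : ℚ) + (((d + 5).choose 6 : ℕ) : ℚ) * ((p + d).choose 4 : ℚ) + (((d + 6).choose 7 : ℕ) : ℚ) * ((p + d).choose 3 : ℚ) + (((d + 7).choose 8 : ℕ) : ℚ) * ((p + d).choose 2 : ℚ) + (((d + 8).choose 9 : ℕ) : ℚ) * (p + d : ℚ) + (((d + 9).choose 10 : ℕ) : ℚ)) +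
      (2 : ℚ) ^ (min 319 (9 + d))) ≤
      ((c₂ : ℕ) : ℚ) * 2 ^ (d - 9) * (((p + 9).choose 9 : ℕ) : ℚ) ∧
      c₁ * (n.choose 9 * 2 ^ (min 310 d) + n.choose 8 * 2 ^ 151 + n.choose 7 * 2 ^ 72 + n.choose 6 * 2 ^ 33 + n.choose 5 * 2 ^ 14 + n.choose 4 * 2 ^ 6 + n.choose 3 * 2 ^ 3 + n.choose 2 * 2 + n + 1 + ∑ j ∈ Finset.range (d + 1), n.choose j) ≤ (c₁ - c₂) * 2 ^ n := by
  interval_cases d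
  · exact ⟨3, 2, by norm_num, by norm_num, level_nine_poly_gxt_10 p hp, mul_tailG_nine_le_of_base 3 1 10 218 (by norm_num) gxt_tail_nine_base_10 n (by omega)⟩
  · exact ⟨2, 1, by norm_num, by norm_num, level_nine_poly_gxt_11 p hp, mul_tailG_nine_le_of_base 2 1 11 219 (by norm_num) gxt_tail_nine_base_11 n (by omega)⟩
  · exact ⟨2, 1, by norm_num, by norm_num, level_nine_poly_gxt_12 p hp, mul_tailG_nine_le_of_base 2 1 12 220 (by norm_num) gxt_tail_nine_base_12 n (by omega)⟩
  · exact ⟨2, 1, by norm_num, by norm_num, level_nine_poly_gxt_13 p hp, mul_tailG_nine_le_of_base 2 1 13 221 (by norm_num) gxt_tail_nine_base_13 n (by omega)⟩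
  · exact ⟨2, 1, by norm_num, by norm_num, level_nine_poly_gxt_14 p hp, mul_tailG_nine_le_of_base 2 1 14 222 (by norm_num) gxt_tail_nine_base_14 n (by omega)⟩
  · exact ⟨2, 1, by norm_num, by norm_num, level_nine_poly_gxt_15 p hp, mul_tailG_nine_le_of_base 2 1 15 223 (by norm_num) gxt_tail_nine_base_15 n (by omega)⟩
  · exact ⟨2, 1, by norm_num, by norm_num, level_nine_poly_gxt_16 p hp, mul_tailG_nine_le_of_base 2 1 16 224 (by norm_num) gxt_tail_nine_base_16 n (by omega)⟩
  · exact ⟨2, 1, by norm_num, by norm_num, level_nine_poly_gxt_17 p hp, mul_tailG_nine_le_of_base 2 1 17 225 (by norm_num) gxt_tail_nine_base_17 n (by omega)⟩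
  · exact ⟨2, 1, by norm_num, by norm_num, level_nine_poly_gxt_18 p hp, mul_tailG_nine_le_of_base 2 1 18 226 (by norm_num) gxt_tail_nine_base_18 n (by omega)⟩
  · exact ⟨2, 1, by norm_num, by norm_num, level_nine_poly_gxt_19 p hp, mul_tailG_nine_le_of_base 2 1 19 227 (by norm_num) gxt_tail_nine_base_19 n (by omega)⟩
  · exact ⟨2, 1, by norm_num, by norm_num, level_nine_poly_gxt_20 p hp, mul_tailG_nine_le_of_base 2 1 20 228 (by norm_num) gxt_tail_nine_base_20 n (by omega)⟩
  · exact ⟨2, 1, by norm_num, by norm_num, level_nine_poly_gxt_21 p hp, mul_tailG_nine_le_of_base 2 1 21 229 (by norm_num) gxt_tail_nine_base_21 n (by omega)⟩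
  · exact ⟨2, 1, by norm_num, by norm_num, level_nine_poly_gxt_22 p hp, mul_tailG_nine_le_of_base 2 1 22 230 (by norm_num) gxt_tail_nine_base_22 n (by omega)⟩
  · exact ⟨2, 1, by norm_num, by norm_num, level_nine_poly_gxt_23 p hp, mul_tailG_nine_le_of_base 2 1 23 231 (by norm_num) gxt_tail_nine_base_23 n (by omega)⟩
  · exact ⟨2, 1, by norm_num, by norm_num, level_nine_poly_gxt_24 p hp, mul_tailG_nine_le_of_base 2 1 24 232 (by norm_num) gxt_tail_nine_base_24 n (by omega)⟩
  · exact ⟨2, 1, by norm_num, by norm_num, level_nine_poly_gxt_25 p hp, mul_tailG_nine_le_of_base 2 1 25 233 (by norm_num) gxt_tail_nine_base_25 n (by omega)⟩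
  · exact ⟨2, 1, by norm_num, by norm_num, level_nine_poly_gxt_26 p hp, mul_tailG_nine_le_of_base 2 1 26 234 (by norm_num) gxt_tail_nine_base_26 n (by omega)⟩
  · exact ⟨2, 1, by norm_num, by norm_num, level_nine_poly_gxt_27 p hp, mul_tailG_nine_le_of_base 2 1 27 235 (by norm_num) gxt_tail_nine_base_27 n (by omega)⟩
  · exact ⟨2, 1, by norm_num, by norm_num, level_nine_poly_gxt_28 p hp, mul_tailG_nine_le_of_base 2 1 28 236 (by norm_num) gxt_tail_nine_base_28 n (by omega)⟩
  · exact ⟨2, 1, by norm_num, by norm_num, level_nine_poly_gxt_29 p hp, mul_tailG_nine_le_of_base 2 1 29 237 (by norm_num) gxt_tail_nine_base_29 n (by omega)⟩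
  · exact ⟨2, 1, by norm_num, by norm_num, level_nine_poly_gxt_30 p hp, mul_tailG_nine_le_of_base 2 1 30 238 (by norm_num) gxt_tail_nine_base_30 n (by omega)⟩
  · exact ⟨2, 1, by norm_num, by norm_num, level_nine_poly_gxt_31 p hp, mul_tailG_nine_le_of_base 2 1 31 239 (by norm_num) gxt_tail_nine_base_31 n (by omega)⟩
  · exact ⟨2, 1, by norm_num, by norm_num, level_nine_poly_gxt_32 p hp, mul_tailG_nine_le_of_base 2 1 32 240 (by norm_num) gxt_tail_nine_base_32 n (by omega)⟩
  · exact ⟨2, 1, by norm_num, by norm_num, level_nine_poly_gxt_33 p hp, mul_tailG_nine_le_of_base 2 1 33 241 (by norm_num) gxt_tail_nine_base_33 n (by omega)⟩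
  · exact ⟨2, 1, by norm_num, by norm_num, level_nine_poly_gxt_34 p hp, mul_tailG_nine_le_of_base 2 1 34 242 (by norm_num) gxt_tail_nine_base_34 n (by omega)⟩
  · exact ⟨2, 1, by norm_num, by norm_num, level_nine_poly_gxt_35 p hp, mul_tailG_nine_le_of_base 2 1 35 243 (by norm_num) gxt_tail_nine_base_35 n (by omega)⟩
  · exact ⟨2, 1, by norm_num, by norm_num, level_nine_poly_gxt_36 p hp, mul_tailG_nine_le_of_base 2 1 36 244 (by norm_num) gxt_tail_nine_base_36 n (by omega)⟩
  · exact ⟨2, 1, by norm_num, by norm_num, level_nine_poly_gxt_37 p hp, mul_tailG_nine_le_of_base 2 1 37 245 (by norm_num) gxt_tail_nine_base_37 n (by omega)⟩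
  · exact ⟨2, 1, by norm_num, by norm_num, level_nine_poly_gxt_38 p hp, mul_tailG_nine_le_of_base 2 1 38 246 (by norm_num) gxt_tail_nine_base_38 n (by omega)⟩
  · exact ⟨2, 1, by norm_num, by norm_num, level_nine_poly_gxt_39 p hp, mul_tailG_nine_le_of_base 2 1 39 247 (by norm_num) gxt_tail_nine_base_39 n (by omega)⟩
  · exact ⟨2, 1, by norm_num, by norm_num, level_nine_poly_gxt_40 p hp, mul_tailG_nine_le_of_base 2 1 40 248 (by norm_num) gxt_tail_nine_base_40 n (by omega)⟩
  · exact ⟨2, 1, by norm_num, by norm_num, level_nine_poly_gxt_41 p hp, mul_tailG_nine_le_of_base 2 1 41 249 (by norm_num) gxt_tail_nine_base_41 n (by omega)⟩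
  · exact ⟨2, 1, by norm_num, by norm_num, level_nine_poly_gxt_42 p hp, mul_tailG_nine_le_of_base 2 1 42 250 (by norm_num) gxt_tail_nine_base_42 n (by omega)⟩
  · exact ⟨2, 1, by norm_num, by norm_num, level_nine_poly_gxt_43 p hp, mul_tailG_nine_le_of_base 2 1 43 251 (by norm_num) gxt_tail_nine_base_43 n (by omega)⟩
  · exact ⟨2, 1, by norm_num, by norm_num, level_nine_poly_gxt_44 p hp, mul_tailG_nine_le_of_base 2 1 44 252 (by norm_num) gxt_tail_nine_base_44 n (by omega)⟩
  · exact ⟨2, 1, by norm_num, by norm_num, level_nine_poly_gxt_45 p hp, mul_tailG_nine_le_of_base 2 1 45 253 (by norm_num) gxt_tail_nine_base_45 n (by omega)⟩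
  · exact ⟨2, 1, by norm_num, by norm_num, level_nine_poly_gxt_46 p hp, mul_tailG_nine_le_of_base 2 1 46 254 (by norm_num) gxt_tail_nine_base_46 n (by omega)⟩
  · exact ⟨2, 1, by norm_num, by norm_num, level_nine_poly_gxt_47 p hp, mul_tailG_nine_le_of_base 2 1 47 255 (by norm_num) gxt_tail_nine_base_47 n (by omega)⟩
  · exact ⟨2, 1, by norm_num, by norm_num, level_nine_poly_gxt_48 p hp, mul_tailG_nine_le_of_base 2 1 48 256 (by norm_num) gxt_tail_nine_base_48 n (by omega)⟩
  · exact ⟨2, 1, by norm_num, by norm_num, level_nine_poly_gxt_49 p hp, mul_tailG_nine_le_of_base 2 1 49 257 (by norm_num) gxt_tail_nine_base_49 n (by omega)⟩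
  · exact ⟨2, 1, by norm_num, by norm_num, level_nine_poly_gxt_50 p hp, mul_tailG_nine_le_of_base 2 1 50 258 (by norm_num) gxt_tail_nine_base_50 n (by omega)⟩
  · exact ⟨2, 1, by norm_num, by norm_num, level_nine_poly_gxt_51 p hp, mul_tailG_nine_le_of_base 2 1 51 259 (by norm_num) gxt_tail_nine_base_51 n (by omega)⟩
  · exact ⟨2, 1, by norm_num, by norm_num, level_nine_poly_gxt_52 p hp, mul_tailG_nine_le_of_base 2 1 52 260 (by norm_num) gxt_tail_nine_base_52 n (by omega)⟩
  · exact ⟨2, 1, by norm_num, by norm_num, level_nine_poly_gxt_53 p hp, mul_tailG_nine_le_of_base 2 1 53 261 (by norm_num) gxt_tail_nine_base_53 n (by omega)⟩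
  · exact ⟨2, 1, by norm_num, by norm_num, level_nine_poly_gxt_54 p hp, mul_tailG_nine_le_of_base 2 1 54 262 (by norm_num) gxt_tail_nine_base_54 n (by omega)⟩
  · exact ⟨2, 1, by norm_num, by norm_num, level_nine_poly_gxt_55 p hp, mul_tailG_nine_le_of_base 2 1 55 263 (by norm_num) gxt_tail_nine_base_55 n (by omega)⟩
  · exact ⟨2, 1, by norm_num, by norm_num, level_nine_poly_gxt_56 p hp, mul_tailG_nine_le_of_base 2 1 56 264 (by norm_num) gxt_tail_nine_base_56 n (by omega)⟩
  · exact ⟨2, 1, by norm_num, by norm_num, level_nine_poly_gxt_57 p hp, mul_tailG_nine_le_of_base 2 1 57 265 (by norm_num) gxt_tail_nine_base_57 n (by omega)⟩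
  · exact ⟨2, 1, by norm_num, by norm_num, level_nine_poly_gxt_58 p hp, mul_tailG_nine_le_of_base 2 1 58 266 (by norm_num) gxt_tail_nine_base_58 n (by omega)⟩
  · exact ⟨2, 1, by norm_num, by norm_num, level_nine_poly_gxt_59 p hp, mul_tailG_nine_le_of_base 2 1 59 267 (by norm_num) gxt_tail_nine_base_59 n (by omega)⟩
  · exact ⟨2, 1, by norm_num, by norm_num, level_nine_poly_gxt_60 p hp, mul_tailG_nine_le_of_base 2 1 60 268 (by norm_num) gxt_tail_nine_base_60 n (by omega)⟩
  · exact ⟨2, 1, by norm_num, by norm_num, level_nine_poly_gxt_61 p hp, mul_tailG_nine_le_of_base 2 1 61 269 (by norm_num) gxt_tail_nine_base_61 n (by omega)⟩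
  · exact ⟨2, 1, by norm_num, by norm_num, level_nine_poly_gxt_62 p hp, mul_tailG_nine_le_of_base 2 1 62 270 (by norm_num) gxt_tail_nine_base_62 n (by omega)⟩
  · exact ⟨2, 1, by norm_num, by norm_num, level_nine_poly_gxt_63 p hp, mul_tailG_nine_le_of_base 2 1 63 271 (by norm_num) gxt_tail_nine_base_63 n (by omega)⟩
  · exact ⟨2, 1, by norm_num, by norm_num, level_nine_poly_gxt_64 p hp, mul_tailG_nine_le_of_base 2 1 64 272 (by norm_num) gxt_tail_nine_base_64 n (by omega)⟩
  · exact ⟨2, 1, by norm_num, by norm_num, level_nine_poly_gxt_65 p hp, mul_tailG_nine_le_of_base 2 1 65 273 (by norm_num) gxt_tail_nine_base_65 n (by omega)⟩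
  · exact ⟨2, 1, by norm_num, by norm_num, level_nine_poly_gxt_66 p hp, mul_tailG_nine_le_of_base 2 1 66 274 (by norm_num) gxt_tail_nine_base_66 n (by omega)⟩
  · exact ⟨2, 1, by norm_num, by norm_num, level_nine_poly_gxt_67 p hp, mul_tailG_nine_le_of_base 2 1 67 275 (by norm_num) gxt_tail_nine_base_67 n (by omega)⟩
  · exact ⟨2, 1, by norm_num, by norm_num, level_nine_poly_gxt_68 p hp, mul_tailG_nine_le_of_base 2 1 68 276 (by norm_num) gxt_tail_nine_base_68 n (by omega)⟩
  · exact ⟨2, 1, by norm_num, by norm_num, level_nine_poly_gxt_69 p hp, mul_tailG_nine_le_of_base 2 1 69 277 (by norm_num) gxt_tail_nine_base_69 n (by omega)⟩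
  · exact ⟨2, 1, by norm_num, by norm_num, level_nine_poly_gxt_70 p hp, mul_tailG_nine_le_of_base 2 1 70 278 (by norm_num) gxt_tail_nine_base_70 n (by omega)⟩
  · exact ⟨2, 1, by norm_num, by norm_num, level_nine_poly_gxt_71 p hp, mul_tailG_nine_le_of_base 2 1 71 279 (by norm_num) gxt_tail_nine_base_71 n (by omega)⟩
  · exact ⟨2, 1, by norm_num, by norm_num, level_nine_poly_gxt_72 p hp, mul_tailG_nine_le_of_base 2 1 72 280 (by norm_num) gxt_tail_nine_base_72 n (by omega)⟩
  · exact ⟨2, 1, by norm_num, by norm_num, level_nine_poly_gxt_73 p hp, mul_tailG_nine_le_of_base 2 1 73 281 (by norm_num) gxt_tail_nine_base_73 n (by omega)⟩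
  · exact ⟨2, 1, by norm_num, by norm_num, level_nine_poly_gxt_74 p hp, mul_tailG_nine_le_of_base 2 1 74 282 (by norm_num) gxt_tail_nine_base_74 n (by omega)⟩
  · exact ⟨2, 1, by norm_num, by norm_num, level_nine_poly_gxt_75 p hp, mul_tailG_nine_le_of_base 2 1 75 283 (by norm_num) gxt_tail_nine_base_75 n (by omega)⟩
  · exact ⟨2, 1, by norm_num, by norm_num, level_nine_poly_gxt_76 p hp, mul_tailG_nine_le_of_base 2 1 76 284 (by norm_num) gxt_tail_nine_base_76 n (by omega)⟩
  · exact ⟨2, 1, by norm_num, by norm_num, level_nine_poly_gxt_77 p hp, mul_tailG_nine_le_of_base 2 1 77 285 (by norm_num) gxt_tail_nine_base_77 n (by omega)⟩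
  · exact ⟨2, 1, by norm_num, by norm_num, level_nine_poly_gxt_78 p hp, mul_tailG_nine_le_of_base 2 1 78 286 (by norm_num) gxt_tail_nine_base_78 n (by omega)⟩
  · exact ⟨2, 1, by norm_num, by norm_num, level_nine_poly_gxt_79 p hp, mul_tailG_nine_le_of_base 2 1 79 287 (by norm_num) gxt_tail_nine_base_79 n (by omega)⟩
  · exact ⟨2, 1, by norm_num, by norm_num, level_nine_poly_gxt_80 p hp, mul_tailG_nine_le_of_base 2 1 80 288 (by norm_num) gxt_tail_nine_base_80 n (by omega)⟩

end ThmN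

end PercRepro
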